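import Summits.QuantumFields.YangMills.Theorems.BalabanUVNodesN08SlotOfRecordFromAlphaAC

/-!
# BalabanUVNodes ∕ N08 — THE LOAD POINT OF E6′, PRICED: the [Balaban1985UV3] SLOT OF RECORD `Node00.PrintedUV3V N L` FROM THE d = 3 LANE'S (α)-AC ROWS AND AN
# EXTENSIVE BOUND ON PRINT'S HISTORY MASSES `m_k(h,U) ≤ exp(c_m·|T₁^{(k)}|)` — the large-field row B25 (pp. 273–274) AT THE AC TOWER from the lane's UNCHANGED
# Theorem-1 chain run on CAPPED masses, the family constant `d` re-booked as `d + c_m`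

Track A, DAG node N08 = T. Bałaban, CMP **102** (1985) 255–275 [Balaban1985UV3]: Thm 1 p. 257 (bounds (5)), Thm 2 p. 272, (41) p. 266, (67)–(71) pp. 273–274, (39) p. 266,
(7) p. 257; print's averaging (2) = [Balaban1985Averaging] (15) p. 19.  Cell `pub-ymgap`, width seat `pub-ymgap-dag-n08-w1` (g3), W-SEAT-START-LIST §n08 item 1 successor
piece (o9) = file 15; `--supports` K1⁷ `StabilityBAtRecordR13SepCoPH` (helper).  Companion of file 14 `…N08SlotOfRecordFromAlphaAC` ((R4‴): the slot of record from
`AlphaAC.RunAlphaAC` + the ONE row B25 read at the AC tower `hlf`, no E6′; B25's lane proof `Run3LargeField.lf_dominated_adm` is where `mass ≤ 1` = exact Haar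
compatibility of `Ū` is consumed).

WHAT THIS FILE PROVES (kernel; theorems only, 0 def; nothing of the paper asserted).
* §1 ★★ `lf_towerAC3_of_massBound` — **ROW B25 FOR AN AC TOWER INPUT `D : TowerAC.TowerInputAC S G` (masses uncapped) UNDER AN EXTENSIVE MASS BOUND**: if
  `m_k(h,U) ≤ exp(c_m·|T₁^{(k)}|)` for `1 ≤ k ≤ K` (`c_m ≥ 0`; masses vanish off admissible histories), then — from exactly the hypotheses of the lane's
  `LiftBridge.lf_tower3_avg` (the (α) displays (67)∘large-field and (68) about `U_k(h,·)`, the coupling window `γ₇₁ᴸ`, collar profile and Z-term coefficients on the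
  window, the provisos NOT IN PRINT) — `LF_k(U)[−(1/g_k²)A(U_k(h,U)) + Σ_j O(log g_j⁻¹)|Z_j|] ≤ exp((d + c_m)·|T₁^{(k)}|)` for the family constant `d = 6∕log L`.
  MECHANISM (inside the proof, no new definition): the std `Carriers.TowerInput` with the CAPPED masses `e^{−c_m|T₁^{(k)}|}·m_k` (`≤ 1`; `= m_0 = 1` at `k = 0`;
  `0` beyond the run) over the SAME averaging (`AvgAC` is all `Carriers.TowerInput` asks), minimisers, regions, coefficients; the lane's large-field chain
  `lf_tower3_avg → Run3SmallFactors.lf_tower3_final → LargeFieldKnitAdm` runs on it VERBATIM; its functional is `e^{−c_m|T₁^{(k)}|}·LFAC`, exponent and `|T₁^{(k)}|`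
  identical (`rfl`) — undo the scaling.
* §2 ★★ `lf_towerOfAC_of_alphaAC_of_massBound` — the same AT THE LANE'S AC TOWER `towerOfAC 𝔠.lane X 𝔖` on the `≤`-family from `RunAlphaAC`'s rows `hLF67`∕`h68`
  (thresholds from `g_k ≤ γ₀`, `FamilyLE.thresholds_of_le`; collar∕Z-term facts `LargeFieldStd.rcolOf_antitone∕rcolOf_le∕zcoefOf_nonneg∕zcoefOf_le`; provisos R-E2′
  `Primitives.prov_r₀p₀`, `Family.prov_hb₁∕prov_hb₂`; masses off admissible histories `StandardAC.stdTowerInputAC_mass_eq_zero_of_not_admissible`) + `hmass`.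
* §3 ★★ `nonempty_analyticLeaves_towerOfAC_of_alphaAC_of_massBound` — the WHOLE analytic bundle `UVStability3D.AnalyticLeaves C′ S (towerOfAC 𝔠.lane X 𝔖)` at the
  RE-BOOKED constants `C′ = {𝔠.lane.consts with d := d + c_m}` from `RunAlphaAC` + `hmass` (file 14 §2 for every other leaf; `C′` differs from the record only in `d`).
* §4 ★★★ `printedUV3V_at_slotOfRecord_of_alphaAC_of_massBound_of_consts` — **THE SLOT OF RECORD `Node00.PrintedUV3V N L` for AC inputs AT PRINT'S OWN AVERAGING pinned to
  the record, from `RunAlphaAC` + `hmass` on the family and `b₀p₀^{p₀}e^{1−p₀} ≤ εbg`** (`C′` is normalised — `NormalisedConsts` pins only `g, L` — and used by the AC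
  towers, so file 14 §3's `printedUV3G_of_analyticLeaves_towerAC3_of_window` applies and `B10RunsOfRecord.UniformLeafSystemsG`'s `∃ C` absorbs `d + c_m`: Thm 1's O(1)
  moves, the slot does not); ★★★ `…_of_consts'` — the A6 form along file 9 §2's inhabitant with the mass bound stated X-FREE on print's own iterated Radon–Nikodym masses
  `MassesAC.massRecAC M₁ Rcol ε_L ε_S (avOfPrint N S) k h U ≤ exp(c_m·|T₁^{(k)}|)`; and the PRIMED slot along any admissible AC averaging
  (`printedUV3V'_at_record_of_alphaAC_of_massBound_of_consts`).

LOCATED READING (count-neutral; the owners — plan ∕ node00-def ∕ pub-balaban3d — decide): (R4⁗) `Node00.PrintedUV3V N L` ⟸ RunAlphaAC(print-averaging AC inputs pinned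
to the record above level 0) ∧ «`m_k(h,U) ≤ exp(c_m|T₁^{(k)}|)`, `1 ≤ k ≤ K`, uniformly on the family, some `c_m ≥ 0`» ∧ `b₀p₀^{p₀}e^{1−p₀} ≤ εbg`.  E6′ (`Ū_*(dU) = dV`, exact —
fibrewise false, globally a ≲10⁻⁴⁸ cancellation question, n08-w3 g3) is thereby REPLACED in N08's residual list by a one-sided EXTENSIVE bound of the shape of (5) itself.
VERSION CAVEAT, SAID: at the lane's AC inputs the masses ARE print's iterated Radon–Nikodym transports `MassesAC.massRecAC … (avOfPrint N S)` (`StandardAC.stdTowerInputAC_mass`,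
`rfl`) — an `rnDeriv` VERSION (`AveragingRT.rnTransport`), `≥ 1` at the trivial history by definition (`one_le_massRecAC_triv`) and otherwise uncapped; a POINTWISE bound on a
version is not a statement real analysis discharges (only `dV`-a.e. ones are), exactly as the std lane's `mass ≤ 1` is not proved but BUILT IN (`Carriers.Masses.massRec` caps
at `1` by definition, and E6′ pays for «transport ≤ mass, a.e.» in `Bound55Std`).  So the located input this file hands on is TWO-PART: (a) ANALYSIS — a `dV`-a.e. extensive
bound for the transports of [Balaban1985Averaging] (15) (`rnTransport (avOfPrint …) (w·m_k) ≤ e^{c_m|T₁^{(k+1)}|}·(…)` a.e.; n08-w3's guard ∕ mixture normal forms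
`…HaarCompatibilityGuardPowerMap` ∕ `…GuardMixture` are the natural tools); (b) BOOKKEEPING — an AC mass carrier CAPPED at `e^{c_m|T₁^{(k)}|}` by definition (as `massRec` caps
at `1`), for which `hmass` is definitional, §1 applies VERBATIM (it is generic in the AC input `D`), and (a) is what its (41)-step (`Bound55AC`'s «transport ≤ mass, a.e.»)
then consumes.  Neither (a) nor (b) is claimed here; `c_m = 0` in (a) would be Haar compatibility a.e.

HONEST FRAMING: count-neutral helper; N08 NOT discharged — the (α)-AC rows and the mass bound are HYPOTHESES = N08's object gap in AC currency; `PrintedUV3V` NOT proved;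
one finite 𝕋⁴ programme at fixed ε, Bałaban AS PRINTED (d = 3 tori of [B10] inside the record) — R4 closes the conditional finite-𝕋⁴ rung `BalabanLadder.UV` only; the
Yang–Mills mass gap (Clay) is NOT proved by any of this; nothing continuum ∕ ℝ⁴ ∕ OS.  No `sorry`, standard axioms.
-/

noncomputable section

namespace Summit.QuantumFields.YangMills.BalabanUVNodes.N08SlotOfRecordFromAlphaACMassBound

open scoped Matrix.Norms.L2Operator
open Literature.MathematicalPhysics.QuantumFieldTheory.Balaban1983to89
open Literature.MathematicalPhysics.QuantumFieldTheory.Balaban1983to89.B10 (TowerRun pFun)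
open Literature.MathematicalPhysics.QuantumFieldTheory.Balaban1983to89.Node00 (SU TFamily₃)
open Literature.MathematicalPhysics.QuantumFieldTheory.Balaban1983to89.B10RunsOfRecord
open Literature.MathematicalPhysics.QuantumFieldTheory.Balaban1985CMP102
open Literature.MathematicalPhysics.QuantumFieldTheory.Balaban1985CMP102.Setting
open Literature.MathematicalPhysics.QuantumFieldTheory.Balaban1985CMP102.Theorems (Family)
open Summit.QuantumFields.Balaban3D
open Summit.QuantumFields.Balaban3D.Carriers (nblkOf StepSeries Hist HistWeights TowerInput rcolOf eps1Of epsSOf)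
open Summit.QuantumFields.Balaban3D.Proofs
open Summit.QuantumFields.Balaban3D.Proofs.ScalesArithmetic
open Summit.QuantumFields.Balaban3D.Proofs.Constants (eps0Of consts3_d_eq_log)
open Summit.QuantumFields.Balaban3D.Proofs.FamilyLE (le_of_eps0Of thresholds_of_le)
open Summit.QuantumFields.Balaban3D.Proofs.Family (prov_hb₁ prov_hb₂)
open Summit.QuantumFields.Balaban3D.Proofs.GroupModelLieC (lieC)
open Summit.QuantumFields.Balaban3D.Proofs.TowerAC (TowerInputAC LFAC)
open Summit.QuantumFields.Balaban3D.Proofs.StandardAC (ExternalInputsAC)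
open Summit.QuantumFields.Balaban3D.Proofs.InputsAC (inputOfAC towerOfAC noInteraction0_towerOfAC)
open Summit.QuantumFields.Balaban3D.Proofs.AlphaAC (AlphaDataAC RunAlphaAC)
open Summit.QuantumFields.Balaban3D.Proofs.AlphaAdaptersAC (logZT_le_piecesAC pprT_le_piecesAC)
open Summit.QuantumFields.Balaban3D.Proofs.Thm2AC (stepLeavesOfAC stepResidualsAC_of_alpha step0_towerOfAC)
open Summit.QuantumFields.Balaban3D.Proofs.Thresholds (gamma71L)
open Summit.QuantumFields.Balaban3D.Proofs.LiftBridge (liftCfg lf_tower3_avg)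
open Summit.QuantumFields.Balaban3D.Proofs.Run3SmallFactors (codeZ)
open Summit.QuantumFields.YangMills.BalabanUVNodes.N08Thm2AsPrintedAtSlotOfRecordAC (exists_TFamily₃_of_av_eq exists_externalInputsAC_ofPrint)
open Summit.QuantumFields.YangMills.BalabanUVNodes.N08Thm2AtRecordFromAlpha (window_of_famConsts pos_of_famConsts consts_adm_of_pos)
open Summit.QuantumFields.YangMills.BalabanUVNodes.N08SlotOfRecordFromAlphaAC
open B7Prop1Explicit (hol plaqWord)
open B7Prop1Local (pdevOn loK plaqHiK)
open B7Prop2Explicit (avgIter)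
open B10LargeField (xlog)

/-! ## §1 Row B25 for an AC tower input under an extensive mass bound: the lane's chain on capped masses -/
section Generic

variable {L : ℕ} {S : Scales L} {G : Type} [GaugeGroup G] [MeasurableSpace G] [HaarData G]

/-- ★★ **`B10Assembly.LeafSystem.lf` FOR AN AC TOWER INPUT UNDER AN EXTENSIVE MASS BOUND** — pp. 273–274 («The analysis of Sect. 3.C [9], which is model independent,
show that these small factors are enough to control all sums in (41) …»): for `D : TowerAC.TowerInputAC S G` (masses `m_k(h,U) ≥ 0`, NOT capped) with `m_k(h,U) ≤
exp(c_m·|T₁^{(k)}|)` for `1 ≤ k ≤ K` and vanishing off admissible histories, and the hypotheses of `LiftBridge.lf_tower3_avg` verbatim — the (α) displays (67) ∘ large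
field and (68) about the composite minimisers `U_k(h,·) = D.UkH`, the window `g_j ≤ γ₇₁ᴸ(C₁)`, the collar profile antitone and `≤ ρ′x(g_i)^{r₀}`, the Z-term coefficients
in `[0, A·x(g_j)]`, `0 < g_j ≤ gs ≤ 1`, the provisos NOT IN PRINT — one gets, for the constants `C` (`C.d = 6∕log L`),
`LF_k(U)[−(1/g_k²)A(U_k(h,U)) + Σ_{j<k} zcoef_j|Z_j|(h)] ≤ exp((C.d + c_m)·|T₁^{(k)}|)` for every `k ≤ K`.  Proof: the std tower input with capped masses
`e^{−c_m|T₁^{(k)}|}·m_k` (inside the proof) has functional `e^{−c_m|T₁^{(k)}|}·LFAC`, the same exponent and `|T₁^{(k)}|` (`rfl`), and satisfies `lf_tower3_avg`.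
[cite: Balaban1985UV3, pp.273–274 + (67)–(68) p.273 + (39)–(41) p.266] -/
theorem lf_towerAC3_of_massBound (𝔊 : GroupModel G) (C : B10Assembly.Consts) (hd : C.d = 6 / Real.log C.L) (hCL : C.L = (L : ℝ))
    (hL : 2 ≤ L) (D : TowerInputAC S G) {ρ' r₀ A gs ε C₁ cm : ℝ}
    (hsites : ∀ k, k ≤ S.K → S.sites k = (Fintype.card (Site S.P k) : ℝ))
    (hW : ∀ (k : ℕ) (h : Hist S.P k) (U : GaugeField S.P k G), ¬ Hist.Admissible D.M₁ D.Rcol k h → D.W.mass k h U = 0)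
    (hcm : 0 ≤ cm)
    (hmass : ∀ k, 1 ≤ k → k ≤ S.K → ∀ (h : Hist S.P k) (U : GaugeField S.P k G), D.W.mass k h U ≤ Real.exp (cm * S.sites k))
    (hε : 0 < ε) (hC₁ : 0 < C₁) (hb₀ : 0 < D.b₀) (hp₀ : 0 < D.p₀)
    (hrun : ∀ j, S.gk j = B10.gRun C.g C.L ε j)
    (hγ : ∀ j, j < S.K → S.gk j ≤ gamma71L C₁ L D.b₀ D.p₀)
    (hLF67 : ∀ k, k ≤ S.K → ∀ (h : Hist S.P k), Hist.Admissible D.M₁ D.Rcol k h → ∀ (U : GaugeField S.P k G),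
      ∀ e ∈ Hist.disc h, S.gk e.1 * B10.pFun D.b₀ D.p₀ (S.gk e.1) ≤
        ‖((hol (avgIter L (liftCfg 𝔊 (D.UkH k h U)) e.1) (codeZ e) (plaqWord e.2.2.1 e.2.2.2) :
            (Matrix (Fin 𝔊.N) (Fin 𝔊.N) ℂ)ˣ) : Matrix (Fin 𝔊.N) (Fin 𝔊.N) ℂ) - 1‖)
    (h68 : ∀ k, k ≤ S.K → ∀ (h : Hist S.P k), Hist.Admissible D.M₁ D.Rcol k h → ∀ (U : GaugeField S.P k G),
      ∀ e ∈ Hist.disc h,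
        pdevOn (loK L e.1 (codeZ e)) (plaqHiK L e.1 (codeZ e) e.2.2.1 e.2.2.2) (liftCfg 𝔊 (D.UkH k h U)) <
          C₁ * (S.gk e.1 * B10.pFun D.b₀ D.p₀ (S.gk e.1)) * (((L : ℝ) ^ e.1)⁻¹) ^ 2)
    (hM : 0 < D.M₁) (hRcol : ∀ i j, i ≤ j → j ≤ S.K → D.Rcol j ≤ D.Rcol i) (hρ : 0 ≤ ρ') (hr : 0 ≤ r₀)
    (hRle : ∀ i, i ≤ S.K → (D.Rcol i : ℝ) ≤ ρ' * xlog (S.gk i) ^ r₀)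
    (hz0 : ∀ j, j < S.K → 0 ≤ D.zcoef j) (hz : ∀ j, j < S.K → D.zcoef j ≤ A * xlog (S.gk j))
    (hA : 0 ≤ A)
    (hg : ∀ j, j ≤ S.K → 0 < S.gk j ∧ S.gk j ≤ gs) (hgs : gs ≤ 1)
    (hp : r₀ * 3 + 2 ≤ 2 * D.p₀)
    (hb₁ : 8 * (A * (2 * (2 * ρ' + 2 * ((L : ℝ) * (3 * ((D.M₁ : ℝ) - 1)) + 3 * ((L : ℝ) - 1)) + 20) * 1) ^ 3 /
      (Real.log C.L / 2)) ≤ 1 / (4 * (𝔊.N : ℝ)) * D.b₀ ^ 2)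
    (hb₂ : 56 ≤ 1 / (4 * (𝔊.N : ℝ)) * D.b₀ ^ 2) :
    ∀ k, k ≤ D.tower3.toTowerRun.K → ∀ U : D.tower3.toTowerRun.Cfg k,
      D.tower3.toTowerRun.LF k U (fun h => -(D.tower3.toTowerRun.mainT k h U) + D.tower3.toTowerRun.Zterm k h) ≤
        Real.exp ((C.d + cm) * D.tower3.toTowerRun.sites k) := by
  classical
  -- the scale profile: `0` at `k = 0` (there `m_0 = 1` must stay `1`), `c_m·|T₁^{(k)}|` above
  let c : ℕ → ℝ := fun k => if k = 0 then 0 else cm * S.sites k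
  have hc_le : ∀ k, c k ≤ cm * S.sites k := fun k => by
    by_cases hk : k = 0
    · simp only [c, if_pos hk]; exact mul_nonneg hcm (sites_nonneg S k)
    · simp only [c, if_neg hk]; exact le_rfl
  -- the CAPPED masses `e^{−c k}·m_k` (zero beyond the run)
  let W' : HistWeights S.P G :=
    { mass := fun k h U => if k ≤ S.K then Real.exp (-(c k)) * D.W.mass k h U else 0
      mass_nonneg := fun k h U => by
        by_cases hk : k ≤ S.K
        · rw [if_pos hk]; exact mul_nonneg (Real.exp_pos _).le (D.W.mass_nonneg k h U)
        · rw [if_neg hk]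
      mass_le_one := fun k h U => by
        by_cases hk : k ≤ S.K
        · rw [if_pos hk]
          by_cases hk0 : k = 0
          · subst hk0
            simp only [c, if_true, neg_zero, Real.exp_zero, one_mul, D.W.mass_zero]
            exact le_rfl
          · have h1 : 1 ≤ k := Nat.one_le_iff_ne_zero.mpr hk0
            simp only [c, if_neg hk0]
            calc Real.exp (-(cm * S.sites k)) * D.W.mass k h U
                ≤ Real.exp (-(cm * S.sites k)) * Real.exp (cm * S.sites k) :=
                  mul_le_mul_of_nonneg_left (hmass k h1 hk h U) (Real.exp_pos _).le
              _ = 1 := by rw [← Real.exp_add, neg_add_cancel, Real.exp_zero]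
        · rw [if_neg hk]; exact zero_le_one
      mass_zero := fun h U => by
        show (if 0 ≤ S.K then Real.exp (-(c 0)) * D.W.mass 0 h U else 0) = 1
        rw [if_pos (Nat.zero_le _)]
        simp only [c, if_true, neg_zero, Real.exp_zero, one_mul, D.W.mass_zero] }
  -- the std tower input over the SAME averaging, minimisers, regions, coefficients
  let D' : TowerInput S G :=
    { ε₁ := D.ε₁, av := D.av, avgAC := D.avgAC, reg := D.reg, Uk := D.Uk, lower := D.lower, upper := D.upper,
      lower_nonneg := D.lower_nonneg, upper_nonneg := D.upper_nonneg, M₁ := D.M₁, Rcol := D.Rcol, b₀ := D.b₀, p₀ := D.p₀, κ₀ := D.κ₀,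
      W := W', UkH := D.UkH, UkH_triv := D.UkH_triv, Pint := D.Pint, zcoef := D.zcoef, rcoef := D.rcoef, Estep := D.Estep }
  have hW' : ∀ (k : ℕ) (h : Hist S.P k) (U : GaugeField S.P k G), ¬ Hist.Admissible D'.M₁ D'.Rcol k h → D'.W.mass k h U = 0 := by
    intro k h U hh
    show (if k ≤ S.K then Real.exp (-(c k)) * D.W.mass k h U else 0) = 0
    by_cases hk : k ≤ S.K
    · rw [if_pos hk, hW k h U hh, mul_zero]
    · rw [if_neg hk]
  have h' := lf_tower3_avg 𝔊 C hd hCL hL D' hsites hW' hε hC₁ hb₀ hp₀ hrun hγ hLF67 h68 hM hRcol hρ hr hRle hz0 hz hA hg hgs hp hb₁ hb₂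
  intro k hk U
  have hkK : k ≤ S.K := hk
  -- the functional of the capped input is the scaled functional, at the same exponent
  have hkey : D'.tower3.toTowerRun.LF k U (fun h => -(D'.tower3.toTowerRun.mainT k h U) + D'.tower3.toTowerRun.Zterm k h) =
      Real.exp (-(c k)) * D.tower3.toTowerRun.LF k U (fun h => -(D.tower3.toTowerRun.mainT k h U) + D.tower3.toTowerRun.Zterm k h) := by
    show Carriers.LF W' k U (fun h => -(D.tower3.toTowerRun.mainT k h U) + D.tower3.toTowerRun.Zterm k h) =
      Real.exp (-(c k)) * LFAC D.W k U (fun h => -(D.tower3.toTowerRun.mainT k h U) + D.tower3.toTowerRun.Zterm k h)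
    unfold Carriers.LF LFAC
    rw [Finset.mul_sum]
    refine Finset.sum_congr rfl fun h _ => ?_
    show (if k ≤ S.K then Real.exp (-(c k)) * D.W.mass k h U else 0) * _ = _
    rw [if_pos hkK, mul_assoc]
  have h1 := h' k hk U
  rw [hkey] at h1
  have hexp : Real.exp (c k) * Real.exp (C.d * D.tower3.toTowerRun.sites k) ≤ Real.exp ((C.d + cm) * D.tower3.toTowerRun.sites k) := by
    rw [← Real.exp_add]
    apply Real.exp_le_exp.mpr
    show c k + C.d * S.sites k ≤ (C.d + cm) * S.sites k
    have := hc_le k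
    linarith
  calc D.tower3.toTowerRun.LF k U (fun h => -(D.tower3.toTowerRun.mainT k h U) + D.tower3.toTowerRun.Zterm k h)
      = Real.exp (c k) * (Real.exp (-(c k)) *
          D.tower3.toTowerRun.LF k U (fun h => -(D.tower3.toTowerRun.mainT k h U) + D.tower3.toTowerRun.Zterm k h)) := by
        rw [← mul_assoc, ← Real.exp_add, add_neg_cancel, Real.exp_zero, one_mul]
    _ ≤ Real.exp (c k) * Real.exp (C.d * D'.tower3.toTowerRun.sites k) := mul_le_mul_of_nonneg_left h1 (Real.exp_pos _).le
    _ ≤ Real.exp ((C.d + cm) * D.tower3.toTowerRun.sites k) := hexp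

end Generic

/-! ## §2 Row B25 at the lane's AC tower from the (α)-AC rows and the mass bound, on the `≤`-family -/
section Lane

variable {L : ℕ} {S : Scales L} {G : Type} [GaugeGroup G] [MeasurableSpace G] [HaarData G] {𝔊 : GroupModel G} {𝔠 : Primitives.AlphaConsts L 𝔊.N}
  {X : ExternalInputsAC S G} {𝔖 : ∀ k, StepSeries S G ↥(lieC 𝔊) (nblkOf S 𝔠.lane.carrier k) k} {𝔄 : AlphaDataAC 𝔊 𝔠 X 𝔖}
  (hle : S.g ^ 2 * S.ε₀ ≤ (min 𝔠.gamma0 1) ^ 2)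
include hle

/-- ★★ **ROW B25 AT THE LANE'S AC TOWER `towerOfAC 𝔠.lane X 𝔖` FROM THE (α)-AC ROWS AND THE MASS BOUND, on the `≤`-family** (AC twin of `AlphaLargeField.lf_tower` ∘
`LargeFieldStd.lf_stdTowerInput` with `d` re-booked as `d + c_m`): (α) rows `hLF67`∕`h68` of `RunAlphaAC`; window `g_j ≤ γ₇₁` from `g_j ≤ γ₀`; every hypothesis about
the lane's DEFINITIONS discharged as in the std lane (collar profile `rcolOf`, Z-coefficients `zcoefOf`, masses off admissible histories, `|T₁^{(k)}| = #T^{(k)}`,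
`g_k = gRun 1 L (g²ε) k`, provisos R-E2′). [cite: Balaban1985UV3, pp.273–274 + (67)–(68) p.273 + (39)–(41) p.266 + (7) p.257] -/
theorem lf_towerOfAC_of_alphaAC_of_massBound (R : RunAlphaAC 𝔊 𝔠 X 𝔖 𝔄) {cm : ℝ} (hcm : 0 ≤ cm)
    (hmass : ∀ k, 1 ≤ k → k ≤ S.K → ∀ (h : Hist S.P k) (U : GaugeField S.P k G),
      (inputOfAC 𝔠.lane X 𝔖).W.mass k h U ≤ Real.exp (cm * S.sites k)) :
    ∀ k, k ≤ (towerOfAC 𝔠.lane X 𝔖).K → ∀ U : (towerOfAC 𝔠.lane X 𝔖).Cfg k,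
      (towerOfAC 𝔠.lane X 𝔖).LF k U (fun h => -((towerOfAC 𝔠.lane X 𝔖).mainT k h U) + (towerOfAC 𝔠.lane X 𝔖).Zterm k h)
        ≤ Real.exp ((𝔠.lane.consts.d + cm) * (towerOfAC 𝔠.lane X 𝔖).sites k) := by
  have hr₀ : 0 ≤ 𝔠.lane.carrier.r₀ := le_trans zero_le_one 𝔠.one_le_r₀
  have hCz : 0 ≤ 𝔠.lane.carrier.Cz + 𝔠.lane.carrier.Cv := add_nonneg 𝔠.Cz_nonneg 𝔠.Cv_nonneg
  have hc₁ : 0 ≤ 𝔠.lane.carrier.c₁ := by show (0 : ℝ) ≤ 3; norm_num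
  have hA : 0 ≤ (𝔠.lane.carrier.Cz + 𝔠.lane.carrier.Cv) + 𝔠.lane.carrier.C₅ + 𝔠.lane.carrier.C₆ +
      (|𝔠.lane.carrier.logσ₀| + 𝔠.lane.carrier.dg) * 𝔠.lane.carrier.c₁ := by
    have := 𝔠.lane.carrier.dg_nonneg
    have := abs_nonneg 𝔠.lane.carrier.logσ₀
    have h5 : 0 ≤ 𝔠.lane.carrier.C₅ := 𝔠.C₅_nonneg
    have h6 : 0 ≤ 𝔠.lane.carrier.C₆ := 𝔠.C₆_nonneg
    positivity
  have hρ : (0 : ℝ) ≤ (𝔠.lane.carrier.R₁ + 1) * 𝔠.lane.carrier.M₁ := by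
    have : 0 ≤ 𝔠.lane.carrier.R₁ := 𝔠.R₁_nonneg
    positivity
  exact lf_towerAC3_of_massBound 𝔊 𝔠.lane.consts (consts3_d_eq_log 𝔠.lane.F 𝔠.lane.sc) rfl S.hL.2 (inputOfAC 𝔠.lane X 𝔖) (gs := 1) (ε := S.g0sq)
    (fun k hk => by exact_mod_cast sites_eq_card S k (by omega))
    (fun k h U hh => StandardAC.stdTowerInputAC_mass_eq_zero_of_not_admissible X 𝔠.lane.carrier 𝔖 k h U hh)
    hcm hmass (g0sq_pos S) 𝔠.C68_pos 𝔠.lane.F.b₀_pos 𝔠.lane.F.p₀_pos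
    (fun j => by rw [show 𝔠.lane.consts.g = 1 from rfl, show 𝔠.lane.consts.L = (L : ℝ) from rfl]; exact gk_eq_gRun_norm S j)
    (fun j hj => (thresholds_of_le hle j hj.le).2.2.2.1) R.hLF67 R.h68 𝔠.lane.F.M₁_pos
    (LargeFieldStd.rcolOf_antitone 𝔠.lane.carrier 𝔠.R₁_nonneg hr₀) hρ hr₀ (LargeFieldStd.rcolOf_le 𝔠.lane.carrier 𝔠.R₁_nonneg hr₀)
    (LargeFieldStd.zcoefOf_nonneg 𝔠.lane.carrier hCz 𝔠.C₅_nonneg 𝔠.C₆_nonneg hc₁)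
    (LargeFieldStd.zcoefOf_le 𝔠.lane.carrier hCz 𝔠.C₅_nonneg 𝔠.C₆_nonneg hc₁) hA
    (fun j hj => ⟨gk_pos S j, gk_le_one S S.gK_le_one j hj⟩) le_rfl 𝔠.prov_r₀p₀ (prov_hb₁ 𝔠 𝔊.N_pos) (prov_hb₂ 𝔠 𝔊.N_pos)

/-- ★★ **THE ANALYTIC BUNDLE AT THE AC TOWER AT THE RE-BOOKED CONSTANTS `C′ = {𝔠.lane.consts with d := d + c_m}` FROM THE (α)-AC ROWS AND THE MASS BOUND** (every leaf
but B25 as in file 14 §2 — `C′` agrees with the record on `C46, z, aP, σmax, dg, κ₀`; B25 from `lf_towerOfAC_of_alphaAC_of_massBound`).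
[cite: Balaban1985UV3, pp.256–274 (the leaves) + (46) p.267 + (65) p.273 + pp.273–274] -/
theorem nonempty_analyticLeaves_towerOfAC_of_alphaAC_of_massBound (R : RunAlphaAC 𝔊 𝔠 X 𝔖 𝔄) {cm : ℝ} (hcm : 0 ≤ cm)
    (hmass : ∀ k, 1 ≤ k → k ≤ S.K → ∀ (h : Hist S.P k) (U : GaugeField S.P k G),
      (inputOfAC 𝔠.lane X 𝔖).W.mass k h U ≤ Real.exp (cm * S.sites k)) :
    Nonempty (UVStability3D.AnalyticLeaves { 𝔠.lane.consts with d := 𝔠.lane.consts.d + cm, d_nonneg := add_nonneg 𝔠.lane.consts.d_nonneg hcm } S (towerOfAC 𝔠.lane X 𝔖)) :=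
  ⟨{ step0 := step0_towerOfAC 𝔠.lane X 𝔖
     noInt0 := noInteraction0_towerOfAC 𝔠.lane X 𝔖
     steps := fun k hk => stepLeavesOfAC k hk (stepResidualsAC_of_alpha hle k hk (R.steps k hk))
     bound46 := bound46_towerOfAC_of_alphaAC hle R
     logZT_le := fun k hk => logZT_le_piecesAC 𝔠.lane X 𝔖 k 𝔠.cT_pos rfl (R.steps k hk).logZT
     PprT_le := fun k hk => pprT_le_piecesAC 𝔠.lane X 𝔖 k hk (by linarith [𝔠.kappa_ge]) 𝔠.C25_nonneg rfl
       (bound25_vac_of_alphaAC hle k hk (R.steps k hk))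
     lf := lf_towerOfAC_of_alphaAC_of_massBound hle R hcm hmass
     starT_eq := fun _ _ => rfl
     logσ₀_le := fun _ _ => le_rfl
     dg_le := fun _ _ => le_rfl
     rem_eq := fun _ _ => rfl }⟩

end Lane

/-! ## §3 The printed pair at the record's binders and THE SLOT OF RECORD from the (α)-AC rows and the mass bound — no E6′ -/
section Slot

variable {N : ℕ} [NeZero N] {L : ℕ} {𝔊 : GroupModel (SU N)} {𝔠 : Primitives.AlphaConsts L 𝔊.N} {εbg cm : ℝ}
  {X : ∀ S : Scales L, ExternalInputsAC S (SU N)}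
  {𝔖 : ∀ (S : Scales L) (k : ℕ), StepSeries S (SU N) ↥(lieC 𝔊) (nblkOf S 𝔠.lane.carrier k) k}
  {𝔄 : ∀ S : Scales L, AlphaDataAC 𝔊 𝔠 (X S) (𝔖 S)}

/-- ★★★ **THE PRINTED PAIR `PrintedUV3G` AT THE RECORD'S BINDERS FROM THE (α)-AC ROWS AND THE MASS BOUND, GIVEN THE WINDOW** — AC external inputs with the record's minimisers
above level 0, `εbg > 0`, the window at every member of `Family L c⋆.eps0`; the family's constants are the RE-BOOKED `C′` (normalised, used by the AC towers), Thm 1's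
«O(1) independent of ε, k» now with `d + c_m`. [cite: Balaban1985UV3, Thm 1 p.257 + Thm 2 p.272 + pp.256–274] -/
theorem printedUV3G_at_record_of_alphaAC_of_massBound_of_window
    (hUk : ∀ (S : Scales L) k (V : GaugeField S.P (k + 1) (SU N)), (X S).Uk k V = UkA N (fun S => (X S).av) S (k + 1) εbg V) (hpos : 0 < εbg)
    (hwin : ∀ S : Family L (eps0Of 𝔠.gamma0), eps1OfPrint
        { eps0 := eps0Of 𝔠.gamma0, E := fun S => B10.Ek (inputOfAC 𝔠.lane (X S) (𝔖 S)).Estep S.K 0,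
          b₀ := 𝔠.lane.F.b₀, p₀ := 𝔠.lane.F.p₀, εbg := εbg } S.1 0 ≤ εbg ∨ 2 < εbg)
    (R : ∀ S : Family L (eps0Of 𝔠.gamma0), RunAlphaAC 𝔊 𝔠 (X S.1) (𝔖 S.1) (𝔄 S.1)) (hcm : 0 ≤ cm)
    (hmass : ∀ S : Family L (eps0Of 𝔠.gamma0), ∀ k, 1 ≤ k → k ≤ S.1.K → ∀ (h : Hist S.1.P k) (U : GaugeField S.1.P k (SU N)),
      (inputOfAC 𝔠.lane (X S.1) (𝔖 S.1)).W.mass k h U ≤ Real.exp (cm * S.1.sites k)) :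
    PrintedUV3G N L (runObjects₀A N (fun S => (X S).av)
      (fun S j => (Carriers.run3 ((inputOfAC 𝔠.lane (X S) (𝔖 S)).toRunInput fun _ => True)).T j) (Backgrounds.ofAvg N L fun S => (X S).av)) := by
  refine printedUV3G_of_analyticLeaves_towerAC3_of_window (fun S => inputOfAC 𝔠.lane (X S) (𝔖 S))
    { eps0 := eps0Of 𝔠.gamma0, E := fun S => B10.Ek (inputOfAC 𝔠.lane (X S) (𝔖 S)).Estep S.K 0,
      b₀ := 𝔠.lane.F.b₀, p₀ := 𝔠.lane.F.p₀, εbg := εbg }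
    (consts_adm_of_pos 𝔠 hpos _) (fun _ _ => rfl) (fun S k V => hUk S k V) (fun _ => rfl) hwin
    (C := { 𝔠.lane.consts with d := 𝔠.lane.consts.d + cm, d_nonneg := add_nonneg 𝔠.lane.consts.d_nonneg hcm }) 𝔠.lane.normalised (fun S => ?_)
    (fun S => nonempty_analyticLeaves_towerOfAC_of_alphaAC_of_massBound (le_of_eps0Of S.1 S.2) (R S) hcm (hmass S))
  have u := usesConsts_inputOfAC 𝔠.lane (X S.1) (𝔖 S.1) fun _ => True
  exact ⟨u.M₁_eq, u.b₀_eq, u.p₀_eq, u.κ₀_eq, u.rcoef_eq, u.Λvol_nonneg⟩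

/-- ★★★ **THE SLOT OF RECORD `Node00.PrintedUV3V N L` FROM THE (α)-AC ROWS AND THE MASS BOUND, `b₀p₀^{p₀}e^{1−p₀} ≤ εbg`** — AC inputs AT PRINT'S OWN AVERAGING
(`(X S).av = avOfPrint N S`) pinned to the record; NO E6′, no `εbg > 2`, no regime condition on `γ₀` (file 13 §5's window from the constants; file 9 §1's transfer to the
slot of record's own binders). [cite: Balaban1985UV3, Thm 1 p.257 + Thm 2 p.272 + (7) p.257; Balaban1985Averaging, (15) p.19] -/
theorem printedUV3V_at_slotOfRecord_of_alphaAC_of_massBound_of_consts (hav : ∀ S, (X S).av = avOfPrint N S)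
    (hUk : ∀ (S : Scales L) k (V : GaugeField S.P (k + 1) (SU N)), (X S).Uk k V = UkA N (fun S => (X S).av) S (k + 1) εbg V)
    (hε : 𝔠.lane.F.b₀ * (𝔠.lane.F.p₀ ^ 𝔠.lane.F.p₀ * Real.exp (1 - 𝔠.lane.F.p₀)) ≤ εbg)
    (R : ∀ S : Family L (eps0Of 𝔠.gamma0), RunAlphaAC 𝔊 𝔠 (X S.1) (𝔖 S.1) (𝔄 S.1)) (hcm : 0 ≤ cm)
    (hmass : ∀ S : Family L (eps0Of 𝔠.gamma0), ∀ k, 1 ≤ k → k ≤ S.1.K → ∀ (h : Hist S.1.P k) (U : GaugeField S.1.P k (SU N)),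
      (inputOfAC 𝔠.lane (X S.1) (𝔖 S.1)).W.mass k h U ≤ Real.exp (cm * S.1.sites k)) :
    Node00.PrintedUV3V N L := by
  obtain ⟨𝔗', h'⟩ := exists_TFamily₃_of_av_eq (N := N) (funext hav)
    (fun S j => (Carriers.run3 ((inputOfAC 𝔠.lane (X S) (𝔖 S)).toRunInput fun _ => True)).T j)
  have hR : runObjects₀A N (fun S => (X S).av) (fun S j => (Carriers.run3 ((inputOfAC 𝔠.lane (X S) (𝔖 S)).toRunInput fun _ => True)).T j)
      (Backgrounds.ofAvg N L fun S => (X S).av) = runObjects₀T N 𝔗' (Backgrounds.ofPrint N L) :=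
    funext fun c => funext fun S => h' c S
  exact ⟨𝔗', hR ▸ printedUV3G_at_record_of_alphaAC_of_massBound_of_window (𝔄 := 𝔄) hUk (pos_of_famConsts hε)
    (fun S => window_of_famConsts hε _ S.1) R hcm hmass⟩

/-- ★★ **THE PRIMED SLOT `Node00.PrintedUV3V' N L` FROM THE (α)-AC ROWS AND THE MASS BOUND along an ADMISSIBLE AC averaging**, `b₀p₀^{p₀}e^{1−p₀} ≤ εbg`.
[cite: Balaban1985UV3, Thm 1 p.257 + Thm 2 p.272; Balaban1987RG1, (0.4)–(0.9) p.253] -/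
theorem printedUV3V'_at_record_of_alphaAC_of_massBound_of_consts (h𝔞 : Node00.AvgAdmissible₃ N fun S => (X S).av)
    (hUk : ∀ (S : Scales L) k (V : GaugeField S.P (k + 1) (SU N)), (X S).Uk k V = UkA N (fun S => (X S).av) S (k + 1) εbg V)
    (hε : 𝔠.lane.F.b₀ * (𝔠.lane.F.p₀ ^ 𝔠.lane.F.p₀ * Real.exp (1 - 𝔠.lane.F.p₀)) ≤ εbg)
    (R : ∀ S : Family L (eps0Of 𝔠.gamma0), RunAlphaAC 𝔊 𝔠 (X S.1) (𝔖 S.1) (𝔄 S.1)) (hcm : 0 ≤ cm)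
    (hmass : ∀ S : Family L (eps0Of 𝔠.gamma0), ∀ k, 1 ≤ k → k ≤ S.1.K → ∀ (h : Hist S.1.P k) (U : GaugeField S.1.P k (SU N)),
      (inputOfAC 𝔠.lane (X S.1) (𝔖 S.1)).W.mass k h U ≤ Real.exp (cm * S.1.sites k)) :
    Node00.PrintedUV3V' N L :=
  ⟨fun S => (X S).av, h𝔞, fun S j => (Carriers.run3 ((inputOfAC 𝔠.lane (X S) (𝔖 S)).toRunInput fun _ => True)).T j,
    printedUV3G_at_record_of_alphaAC_of_massBound_of_window (𝔄 := 𝔄) hUk (pos_of_famConsts hε)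
      (fun S => window_of_famConsts hε _ S.1) R hcm hmass⟩

variable (N L) in
/-- ★★★ **THE SLOT OF RECORD FROM ITS AC RESIDUALS WITH THE MASS BOUND STATED ON PRINT'S OWN MASSES — A6 FORM** (file 9 §2's inhabitant: AC external inputs AT PRINT'S
AVERAGING with the record's classes and minimisers EXIST; their history masses ARE print's iterated Radon–Nikodym transports `MassesAC.massRecAC M₁ Rcol ε_L ε_S (avOfPrint N S)`
by `rfl`): for every `SU(N)`, `𝔠`, `εbg` with `b₀p₀^{p₀}e^{1−p₀} ≤ εbg`, and `c_m ≥ 0`, THERE ARE such inputs `X`, and for every expansion data `𝔖` and (α)-AC data `𝔄` over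
them, **the (α)-AC rows on the family ∧ «`massRecAC … (avOfPrint N S) k h U ≤ exp(c_m|T₁^{(k)}|)`, `1 ≤ k ≤ K`» ⇒ `Node00.PrintedUV3V N L`** — the X-free, E6′-free letter of
N08's slot of record at the lane's OWN mass version.  VERSION CAVEAT (module docstring): `massRecAC` is an `rnDeriv` version, so this pointwise antecedent is the LETTER a capped
re-selection of the lane's AC masses makes definitional — not a statement to attack by analysis as typed (the analysis is its `dV`-a.e. form).
[cite: Balaban1985UV3, Thm 1 p.257 + Thm 2 p.272 + (41) p.266 + pp.273–274; Balaban1985Averaging, (15) p.19] -/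
theorem printedUV3V_at_slotOfRecord_of_alphaAC_of_massBound_of_consts' (𝔊 : GroupModel (SU N)) (𝔠 : Primitives.AlphaConsts L 𝔊.N) (εbg cm : ℝ)
    (hε : 𝔠.lane.F.b₀ * (𝔠.lane.F.p₀ ^ 𝔠.lane.F.p₀ * Real.exp (1 - 𝔠.lane.F.p₀)) ≤ εbg) (hcm : 0 ≤ cm)
    (hmass : ∀ S : Family L (eps0Of 𝔠.gamma0), ∀ k, 1 ≤ k → k ≤ S.1.K → ∀ (h : Hist S.1.P k) (U : GaugeField S.1.P k (SU N)),
      MassesAC.massRecAC 𝔠.lane.carrier.M₁ (rcolOf S.1 𝔠.lane.carrier) (eps1Of S.1 𝔠.lane.carrier) (epsSOf S.1 𝔠.lane.carrier) (avOfPrint N S.1) k h U ≤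
        Real.exp (cm * S.1.sites k)) :
    ∃ X : ∀ S : Scales L, ExternalInputsAC S (SU N), (∀ S, (X S).av = avOfPrint N S) ∧
      ∀ (𝔖 : ∀ (S : Scales L) (k : ℕ), StepSeries S (SU N) ↥(lieC 𝔊) (nblkOf S 𝔠.lane.carrier k) k)
        (𝔄 : ∀ S : Scales L, AlphaDataAC 𝔊 𝔠 (X S) (𝔖 S)),
        (∀ S : Family L (eps0Of 𝔠.gamma0), RunAlphaAC 𝔊 𝔠 (X S.1) (𝔖 S.1) (𝔄 S.1)) → Node00.PrintedUV3V N L := by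
  obtain ⟨X, hav, -, hUk⟩ := exists_externalInputsAC_ofPrint N L εbg
  refine ⟨X, hav, fun 𝔖 𝔄 R => printedUV3V_at_slotOfRecord_of_alphaAC_of_massBound_of_consts (𝔄 := 𝔄) hav hUk hε R hcm fun S k hk1 hkK h U => ?_⟩
  rw [show (inputOfAC 𝔠.lane (X S.1) (𝔖 S.1)).W.mass k h U = _ from StandardAC.stdTowerInputAC_mass (X S.1) 𝔠.lane.carrier (𝔖 S.1) k h U]
  have hX : (X S.1).av = avOfPrint N S.1 := hav S.1
  rw [hX]
  exact hmass S k hk1 hkK h U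

end Slot

end Summit.QuantumFields.YangMills.BalabanUVNodes.N08SlotOfRecordFromAlphaACMassBound

end
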